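import Summits.Ventures.PercRepro.C041ZoneOCubeDefs
import Summits.Ventures.PercRepro.C041ZoneZPerZoneLemma

/-!
# The per-zone reading of the ZONE O-CUBE predicates, both sides (p6, gen 27; C-041.md §14 (a), (c))

Setting of `C041ZoneZPerZoneLemma` and `C041ZoneOCubeDefs`.  Side `b` of the per-zone machinery: `REACH_Z` on side `b`
(`ReachZoneB`: the red reach inside `Z` of the anchors not in the blue cluster of `b` through vertices outside it),
its (F4) (`reachZoneB_of_bareWalkAvoiding`, the mirror of `reachZone_of_bareWalkAvoiding`), and the per-zone
dictionary for the abstract `D2` / `REACH2` of `zoneFZ` (`zone_mem_D2_iff`, `zone_not_mem_cluster_b_iff`,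
`zone_mem_REACH2_iff`).  Then the ZONE O-CUBE predicates of the abstract zone read on the tree's zone-state:
`G1 ⟺` a red `b`-edge at `REACH_Z` (`zone_G1_iff`), `G2 ⟺` a red `a`-edge at `REACH_Z` on side `b` (`zone_G2_iff`),
`Valid ⟺ ValidZone` (`zone_valid_iff`).
-/

namespace PercRepro

namespace MultiGraph

open Finset ZoneZ ZoneZ.ZoneData

variable {V E : Type*} {G : MultiGraph V E} {a b c : V}

section ReachB

variable (G a b c)

/-- `REACH_Z` on side `b`: the vertices of `Z` reachable from an anchor outside the blue cluster of `b` by a red walk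
inside `Z` through vertices outside the blue cluster of `b`. -/
def ReachZoneB (O S : Config E) (Z : Finset V) (v : V) : Prop :=
  ∃ w ∈ Z, w ∈ G.BareReach a b c O ∧ w ∉ G.cluster Sᶜ b ∧
    Relation.ReflTransGen (fun x y => G.RedIn a b S Z x y ∧ y ∉ G.cluster Sᶜ b) w v

variable {G a b c}

/-- **(F4), side `b`**: a red bare walk from the probe avoiding the blue cluster of `b` that ends in the zone `Z = zone z`
of a tail-free `O` ends in `REACH_Z` on side `b`. -/
theorem reachZoneB_of_bareWalkAvoiding [Fintype V] {O S : Config E} (hO : G.TailFree a b c O)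
    (hc : c ∉ G.cluster Sᶜ b) {z v : V} (hv : v ∈ G.zone a b O z)
    (h : Relation.ReflTransGen (fun x y => G.BareAdj a b S x y ∧ y ∉ G.cluster Sᶜ b) c v) :
    G.ReachZoneB a b c O S (G.zone a b O z) v := by
  have key : ∀ x, Relation.ReflTransGen (fun x y => G.BareAdj a b S x y ∧ y ∉ G.cluster Sᶜ b) c x →
      x ∉ G.zone a b O z ∨ G.ReachZoneB a b c O S (G.zone a b O z) x := by
    intro x hx
    induction hx with
    | refl =>
      by_cases hcz : c ∈ G.zone a b O z
      · exact Or.inr ⟨c, hcz, Relation.ReflTransGen.refl, hc, Relation.ReflTransGen.refl⟩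
      · exact Or.inl hcz
    | @tail x y _ hxy ih =>
      obtain ⟨⟨e, he, hSe, hj⟩, hyD⟩ := hxy
      by_cases hyz : y ∈ G.zone a b O z
      · right
        rcases ih with hxz | ⟨w, hwz, hwK, hwD, hwx⟩
        · have hOe : O e = true := O_red_of_leaves_zone a b hxz hyz he hj
          have hyK : y ∈ G.BareReach a b c O := by
            rcases hj with ⟨_, h2⟩ | ⟨h1, _⟩
            · exact h2 ▸ (hO e he hOe).2
            · exact h1 ▸ (hO e he hOe).1
          exact ⟨y, hyz, hyK, hyD, Relation.ReflTransGen.refl⟩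
        · have hxz : x ∈ G.zone a b O z := mem_of_redIn_walk hwz (redIn_walk_of_avoiding a b hwx)
          exact ⟨w, hwz, hwK, hwD, hwx.tail ⟨⟨e, zoneEdge_of_joins he hj hxz hyz, he, hSe, hj⟩, hyD⟩⟩
      · exact Or.inl hyz
  rcases key v h with hvz | hreach
  · exact absurd hv hvz
  · exact hreach

/-- A vertex of `REACH_Z` on side `b` lies in `Z`. -/
theorem mem_of_reachZoneB {O S : Config E} {Z : Finset V} {w : V} (h : G.ReachZoneB a b c O S Z w) : w ∈ Z := by
  obtain ⟨w₀, hw₀, _, _, hw⟩ := h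
  exact mem_of_redIn_walk hw₀ (redIn_walk_of_avoiding a b hw)

end ReachB

section Zone

variable [Fintype V] (hc : c ≠ a ∧ c ≠ b) (O : Config E) {Z : Finset V} (hZ : G.IsIdxZone a b c O Z)
  (x : G.ZoneState a b Z)

include hc hZ

/-- The side-`2` deleted vertices are the vertices of `Z` whose sub-zone is attached to `b`. -/
theorem zone_mem_D2_iff (hsub : G.BlueSub a b O (G.extZone a b O Z x)) {v : V} (hv : v ∈ Z) :
    v ∈ (G.zoneFZ a b O Z).D2 (G.toStZ a b Z x) ↔ G.Attached a b (G.extZone a b O Z x) v b := by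
  unfold ZoneData.D2
  exact zone_mem_reach_M_iff hc O hZ x hsub hv

/-- For an admissible extension, a vertex of `Z` is outside the blue cluster of `b` iff it is not deleted on side `2`. -/
theorem zone_not_mem_cluster_b_iff (hsub : G.BlueSub a b O (G.extZone a b O Z x))
    (hadm : ¬ G.Conn (G.extZone a b O Z x)ᶜ a b) {v : V} (hv : v ∈ Z) :
    v ∉ G.cluster (G.extZone a b O Z x)ᶜ b ↔ v ∉ (G.zoneFZ a b O Z).D2 (G.toStZ a b Z x) := by
  rw [mem_cluster_compl_iff_attached' a b hadm (ne_terminal_of_mem_idxZone hc hZ hv), zone_mem_D2_iff hc O hZ x hsub hv]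

/-- `REACH2` with the anchors of the zone is `REACH_Z` on side `b`, for an admissible extension. -/
theorem zone_mem_REACH2_iff (hsub : G.BlueSub a b O (G.extZone a b O Z x))
    (hadm : ¬ G.Conn (G.extZone a b O Z x)ᶜ a b) (v : V) :
    v ∈ (G.zoneFZ a b O Z).REACH2 (G.zoneA a b c O Z) (G.toStZ a b Z x) ↔
      G.ReachZoneB a b c O (G.extZone a b O Z x) Z v := by
  unfold ZoneData.REACH2 ZoneData.reachIn ReachZoneB
  constructor
  · rintro ⟨s, ⟨⟨hs, hsK⟩, hsD⟩, h⟩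
    refine ⟨s, hs, hsK, (zone_not_mem_cluster_b_iff hc O hZ x hsub hadm hs).2 hsD, ?_⟩
    induction h with
    | refl => exact Relation.ReflTransGen.refl
    | tail hpre hxy ih =>
      obtain ⟨hxy, _, hyD⟩ := hxy
      have hy : _ ∈ Z :=
        mem_of_redIn_walk hs ((rtg_of_imp (fun _ _ h => (zone_redAdj_iff O x).1 h.1) hpre).tail
          ((zone_redAdj_iff O x).1 hxy))
      exact ih.tail ⟨(zone_redAdj_iff O x).1 hxy, (zone_not_mem_cluster_b_iff hc O hZ x hsub hadm hy).2 hyD⟩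
  · rintro ⟨s, hs, hsK, hsD, h⟩
    refine ⟨s, ⟨⟨hs, hsK⟩, (zone_not_mem_cluster_b_iff hc O hZ x hsub hadm hs).1 hsD⟩, ?_⟩
    induction h with
    | refl => exact Relation.ReflTransGen.refl
    | @tail u w hpre hxy ih =>
      obtain ⟨hxy, hyD⟩ := hxy
      have hx : u ∈ Z := mem_of_redIn_walk hs (rtg_of_imp (fun _ _ h => h.1) hpre)
      have hy : w ∈ Z := mem_of_redIn_walk hx (Relation.ReflTransGen.single hxy)
      have hxD : u ∉ (G.zoneFZ a b O Z).D2 (G.toStZ a b Z x) := by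
        rcases Relation.ReflTransGen.cases_tail hpre with heq | ⟨_, _, hlast⟩
        · rw [heq]
          exact (zone_not_mem_cluster_b_iff hc O hZ x hsub hadm hs).1 hsD
        · exact (zone_not_mem_cluster_b_iff hc O hZ x hsub hadm hx).1 hlast.2
      exact ih.tail ⟨(zone_redAdj_iff O x).2 hxy, hxD, (zone_not_mem_cluster_b_iff hc O hZ x hsub hadm hy).1 hyD⟩

/-- `G1` on the zone: a red `b`-edge at a vertex of `REACH_Z`. -/
theorem zone_G1_iff (hsub : G.BlueSub a b O (G.extZone a b O Z x))
    (hadm : ¬ G.Conn (G.extZone a b O Z x)ᶜ a b) :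
    (G.zoneFZ a b O Z).G1 (G.zoneA a b c O Z) (G.toStZ a b Z x) ↔
      ∃ w, G.ReachZone a b c O (G.extZone a b O Z x) Z w ∧ ∃ e, G.Joins e w b ∧ G.extZone a b O Z x e = true := by
  unfold ZoneData.G1
  constructor
  · rintro ⟨w, hwR, hwMt⟩
    rw [zone_mem_REACH_iff hc O hZ x hsub hadm] at hwR
    obtain ⟨_, e, hj, hSe⟩ := (zone_mem_Mt_iff hc O hZ x w).1 hwMt
    exact ⟨w, hwR, e, hj, hSe⟩
  · rintro ⟨w, hwR, e, hj, hSe⟩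
    refine ⟨w, (zone_mem_REACH_iff hc O hZ x hsub hadm w).2 hwR, ?_⟩
    exact (zone_mem_Mt_iff hc O hZ x w).2 ⟨mem_of_reachZone a b c hwR, e, hj, hSe⟩

/-- `G2` on the zone: a red `a`-edge at a vertex of `REACH_Z` on side `b`. -/
theorem zone_G2_iff (hsub : G.BlueSub a b O (G.extZone a b O Z x))
    (hadm : ¬ G.Conn (G.extZone a b O Z x)ᶜ a b) :
    (G.zoneFZ a b O Z).G2 (G.zoneA a b c O Z) (G.toStZ a b Z x) ↔
      ∃ w, G.ReachZoneB a b c O (G.extZone a b O Z x) Z w ∧ ∃ e, G.Joins e w a ∧ G.extZone a b O Z x e = true := by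
  unfold ZoneData.G2
  constructor
  · rintro ⟨w, hwR, hwBlt⟩
    rw [zone_mem_REACH2_iff hc O hZ x hsub hadm] at hwR
    obtain ⟨_, e, hj, hSe⟩ := (zone_mem_Blt_iff hc O hZ x w).1 hwBlt
    exact ⟨w, hwR, e, hj, hSe⟩
  · rintro ⟨w, hwR, e, hj, hSe⟩
    refine ⟨w, (zone_mem_REACH2_iff hc O hZ x hsub hadm w).2 hwR, ?_⟩
    exact (zone_mem_Blt_iff hc O hZ x w).2 ⟨mem_of_reachZoneB hwR, e, hj, hSe⟩

/-- `Valid` on the zone is `ValidZone`. -/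
theorem zone_valid_iff :
    (G.zoneFZ a b O Z).Valid (G.zoneA a b c O Z) (G.toStZ a b Z x) ↔ G.ValidZone a b c O Z x :=
  zone_validZone_iff hc O hZ x

end Zone

end MultiGraph

end PercRepro
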